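import Summits.CriticalPhenomena.PercolationContinuityZ3.Theorems.PercAnnulusCrossingOSSSCritical
import Summits.CriticalPhenomena.PercolationContinuityZ3.Theorems.PercAnnulusCrossingOSSSUpper
import HarnessLib

/-!
# RSW3 lane (lead, gen 19): OSSS FOR CROSSINGS, V — the real-space renormalisation map of the cube is INFINITELY STEEP at its fixed points:
# at every fixed point `R_n(p*) = p*` of `R_n = Π_·(n)`, `(n+1)/(4S_{n+1}(p*)) ≤ R_n′(p*) ≤ (n+1)·√(24·S_{n+1}(p*))`

builds on p205010 (kernel theorem, internal audit signed; external expert review pending) — USED only in §2 (`S_{n+1}(p)/(n+1) → 0` uniformly near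
`p_c`, through part III; and V224's localisation of the fixed points, which uses the walls OFF `p_c`).

Cell `prim-rsw3` (LANE 3), lead seat, gen 19.  Support file (`--supports stmt-CriticalPhenomena-4575`); no definitions, no named facts, no sorries.
V224 (`…RenormalisationFixedPoints.lean`) showed that the large-cell RG map `R_n(p) = Π_p(n) = P_p({0..n}³ crossed)` has non-trivial fixed points near
`p_c(ℤ³)`, that they converge to `p_c`, and that the RG exponent estimate `ν_RG = log(n+1)/log R_n′(p*)` obeys `ν_RG ≥ 2/3` because `R_n` is
`C(n+1)^{3/2}`-Lipschitz (CCFS).  AT A FIXED POINT the factor `Π(1−Π) = p*(1−p*)` of parts II–IV CANCELS against Russo's `p(1−p)`: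

* §1 (every `n`, every fixed point `p* ∈ (0,1)`, no p205010) **`rg_deriv_ge_osss`** — `(n+1)/(4·S_{n+1}(p*)) ≤ R_n′(p*)` (OSSS, part II);
  **`rg_deriv_sq_le_osss`** — `R_n′(p*)² ≤ 24·(n+1)²·S_{n+1}(p*)` (O'Donnell–Servedio, part IV): the RG 'eigenvalue' `λ_RG = R_n′(p*)` is bracketed by
  the Cesàro sum of the one-arm probabilities AT THE FIXED POINT, `(n+1)/(4S) ≤ λ_RG ≤ (n+1)√(24S)` — no band condition, no `δ`.
* §2 (`ℤ³`, p205010) **`tendsto_rg_deriv_atTop`** — along any sequence of fixed points `u_n` of `R_n` in a band `[ε, 1−ε]` (they converge to `p_c`,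
  V224): `R_n′(u_n) → ∞` — the RG map becomes infinitely steep at its fixed points (V224 had only the ceiling `λ_RG ≤ C(n+1)^{3/2}`); quantitatively
  `λ_RG ≥ (n+1)/(4S_{n+1}(u_n))` with `S_{n+1}(u_n)/(n+1) → 0`.
Reading: `λ_RG = b^{1/ν}` in finite-size scaling, `S_n ≈ n^{1−x}` (`x = β/ν`): the bracket reads `x ≤ 1/ν_RG ≤ (3−x)/2`, i.e. `2/(3−x) ≤ ν_RG ≤ 1/x`
(census `x ≈ 0.48`: `0.79 ≤ ν ≤ 2.1` around `ν = 0.876`; V224: `ν_RG ≥ 2/3`).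

References: P. J. Reynolds, H. E. Stanley, W. Klein, Phys. Rev. B 21 (1980); K. Christensen, N. R. Moloney, *Complexity and Criticality* (2005) §1.11.3
(1.130)–(1.131); Duminil-Copin–Raoufi–Tassion (2019) §3; O'Donnell–Servedio (2007); Chayes–Chayes–Fisher–Spencer (1986).
-/

noncomputable section

namespace Summit.CriticalPhenomena.PercolationContinuityZ3.Theorems.Crossing

open MeasureTheory Filter Topology Finset
open Literature.Probability.Percolation Literature.Probability.LatticeModels

/-! ## §1 The RG eigenvalue at a fixed point, bracketed by the one-arm Cesàro sum -/

/-- **OSSS AT AN RG FIXED POINT** (every `n`, no p205010): if `Π_{p*}(n) = p*` with `0 < p* < 1` then **`(n+1)/(4·S_{n+1}(p*)) ≤ R_n′(p*)`** — part II's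
`(n+1)Π(1−Π) ≤ 4p(1−p)S_{n+1}Π′` with `Π(1−Π) = p*(1−p*)` cancelled. [cite: ChristensenMoloney2005, §1.11.3 eq. (1.131) (ν = log b / log R_b′(p*))]
[cite: DuminilCopinRaoufiTassion2019, §3 eq. (3.4)] -/
theorem rg_deriv_ge_osss (n : ℕ) (p : unitInterval) (hp0 : 0 < (p : ℝ)) (hp1 : (p : ℝ) < 1) (hfix : boxCrossProb 3 p (cubeShape n) 0 = p) :
    ((n : ℝ) + 1) / (4 * ∑ j ∈ Finset.range (n + 1), oneArmProb 3 p j)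
      ≤ deriv (fun q : ℝ => boxCrossProb 3 (Set.projIcc (0 : ℝ) 1 zero_le_one q) (cubeShape n) 0) p := by
  obtain ⟨D, hD, hD0, h⟩ := exists_hasDerivAt_boxCrossProb_ge_osss (cubeShape n) 0 (p := (p : ℝ)) ⟨hp0, hp1⟩
  rw [hD.deriv]
  have hℓ : (cubeShape n 0).toNat = n := by simp [cubeShape]
  rw [hℓ] at h
  simp only [Set.projIcc_val zero_le_one p] at h
  push_cast at h
  rw [hfix] at h
  set S : ℝ := ∑ j ∈ Finset.range (n + 1), oneArmProb 3 p j with hS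
  have hS1 : 1 ≤ S := by
    have h0 : oneArmProb 3 p 0 = 1 := FiniteSizeSharpness.real_siteToBoundary_zero (d := 3) (by norm_num) p
    have : oneArmProb 3 p 0 ≤ S := by
      rw [hS]; exact Finset.single_le_sum (f := fun j => oneArmProb 3 p j) (fun _ _ => measureReal_nonneg)
        (Finset.mem_range.2 (Nat.succ_pos n))
    linarith
  have hpp : 0 < (p : ℝ) * (1 - p) := mul_pos hp0 (by linarith)
  -- `(n+1)·p(1−p) ≤ 4p(1−p)·S·D` ⇒ `(n+1) ≤ 4S·D`
  have h1 : ((n : ℝ) + 1) ≤ 4 * S * D := by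
    have h2 : ((n : ℝ) + 1) * ((p : ℝ) * (1 - p)) ≤ (4 * S * D) * ((p : ℝ) * (1 - p)) := by
      calc ((n : ℝ) + 1) * ((p : ℝ) * (1 - p)) ≤ 4 * ((p : ℝ) * (1 - p)) * S * D := h
        _ = (4 * S * D) * ((p : ℝ) * (1 - p)) := by ring
    exact le_of_mul_le_mul_right h2 hpp
  rw [div_le_iff₀ (by linarith)]
  linarith

/-- **O'DONNELL–SERVEDIO AT AN RG FIXED POINT** (every `n`, no p205010): if `Π_{p*}(n) = p*` with `0 < p* < 1` then **`R_n′(p*)² ≤ 24·(n+1)²·S_{n+1}(p*)`**,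
i.e. `λ_RG ≤ (n+1)√(24 S_{n+1}(p*))` — part IV's `p(1−p)Π′² ≤ 24(n+1)²SΠ(1−Π)` with `Π(1−Π) = p*(1−p*)` cancelled (V224: `λ_RG ≤ (√(3/2)/δ)(n+1)^{3/2}` on
`[δ, 1−δ]`). [cite: ChristensenMoloney2005, §1.11.3 eq. (1.131)] [cite: DewanMuirhead2022, Prop. 2.2] -/
theorem rg_deriv_sq_le_osss (n : ℕ) (p : unitInterval) (hp0 : 0 < (p : ℝ)) (hp1 : (p : ℝ) < 1) (hfix : boxCrossProb 3 p (cubeShape n) 0 = p) :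
    deriv (fun q : ℝ => boxCrossProb 3 (Set.projIcc (0 : ℝ) 1 zero_le_one q) (cubeShape n) 0) p ^ 2
      ≤ 24 * ((n : ℝ) + 1) ^ 2 * ∑ j ∈ Finset.range (n + 1), oneArmProb 3 p j := by
  have h := cube_deriv_sq_le_osss n p hp0 hp1
  rw [hfix] at h
  have hpp : 0 < (p : ℝ) * (1 - p) := mul_pos hp0 (by linarith)
  set D : ℝ := deriv (fun q : ℝ => boxCrossProb 3 (Set.projIcc (0 : ℝ) 1 zero_le_one q) (cubeShape n) 0) p with hDdef
  set S : ℝ := ∑ j ∈ Finset.range (n + 1), oneArmProb 3 p j with hS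
  have h2 : D ^ 2 * ((p : ℝ) * (1 - p)) ≤ (24 * ((n : ℝ) + 1) ^ 2 * S) * ((p : ℝ) * (1 - p)) := by
    calc D ^ 2 * ((p : ℝ) * (1 - p)) = ((p : ℝ) * (1 - p)) * D ^ 2 := by ring
      _ ≤ 24 * ((n : ℝ) + 1) ^ 2 * S * ((p : ℝ) * (1 - p)) := h
      _ = _ := by ring
  exact le_of_mul_le_mul_right h2 hpp

/-- **THE RG EIGENVALUE BRACKET** (every `n`, every fixed point `p* ∈ (0,1)`): `(n+1)/(4S_{n+1}(p*)) ≤ λ_RG` and `λ_RG² ≤ 24(n+1)²S_{n+1}(p*)`, together.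
[cite: ChristensenMoloney2005, §1.11.3 eq. (1.131)] [cite: ReynoldsStanleyKlein1980, §II (large-cell renormalisation)] -/
theorem rg_deriv_two_sided_osss (n : ℕ) (p : unitInterval) (hp0 : 0 < (p : ℝ)) (hp1 : (p : ℝ) < 1) (hfix : boxCrossProb 3 p (cubeShape n) 0 = p) :
    ((n : ℝ) + 1) / (4 * ∑ j ∈ Finset.range (n + 1), oneArmProb 3 p j)
        ≤ deriv (fun q : ℝ => boxCrossProb 3 (Set.projIcc (0 : ℝ) 1 zero_le_one q) (cubeShape n) 0) p ∧
      deriv (fun q : ℝ => boxCrossProb 3 (Set.projIcc (0 : ℝ) 1 zero_le_one q) (cubeShape n) 0) p ^ 2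
        ≤ 24 * ((n : ℝ) + 1) ^ 2 * ∑ j ∈ Finset.range (n + 1), oneArmProb 3 p j :=
  ⟨rg_deriv_ge_osss n p hp0 hp1 hfix, rg_deriv_sq_le_osss n p hp0 hp1 hfix⟩

/-! ## §2 The RG map is infinitely steep at its fixed points (`ℤ³`, θ(p_c) = 0) -/

/-- **`λ_RG → ∞` ALONG THE FIXED POINTS** (`ℤ³`; p205010): if `u_n` is eventually a fixed point of `R_n` lying in a band `[ε, 1−ε]`, then
`R_n′(u_n) → ∞` — the fixed points converge to `p_c` (V224 `tendsto_cube_rgFixedPoint`), so `S_{n+1}(u_n) ≤ η(n+1)` eventually for every `η`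
(`eventually_sum_oneArmProb_le_mul`, θ(p_c) = 0), and `R_n′(u_n) ≥ (n+1)/(4S_{n+1}(u_n)) ≥ 1/(4η)`.  (V224: `R_n′ ≤ (√(3/2)/ε)(n+1)^{3/2}`.)
[cite: ChristensenMoloney2005, §1.11.3–§1.11.4] [cite: ReynoldsStanleyKlein1980, §II] -/
theorem tendsto_rg_deriv_atTop {ε : ℝ} (hε : 0 < ε) {u : ℕ → unitInterval}
    (hfix : ∀ᶠ n in atTop, boxCrossProb 3 (u n) (cubeShape n) 0 = u n)
    (hband : ∀ᶠ n in atTop, ε ≤ (u n : ℝ) ∧ (u n : ℝ) ≤ 1 - ε) :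
    Tendsto (fun n : ℕ => deriv (fun q : ℝ => boxCrossProb 3 (Set.projIcc (0 : ℝ) 1 zero_le_one q) (cubeShape n) 0) (u n)) atTop atTop := by
  have hconv := tendsto_cube_rgFixedPoint hε hfix hband
  rw [tendsto_atTop]
  intro M
  -- choose `η` with `1/(4η) ≥ M`, i.e. `η = 1/(4(|M|+1))`
  have hη : 0 < 1 / (4 * (|M| + 1)) := by positivity
  obtain ⟨δ, hδ, hev⟩ := eventually_sum_oneArmProb_le_mul hη
  have hnear : ∀ᶠ n : ℕ in atTop, (u n : ℝ) ≤ criticalProbI 3 + δ :=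
    (hconv.eventually (eventually_lt_nhds (show (criticalProbI 3 : ℝ) < criticalProbI 3 + δ by linarith))).mono fun n hn => hn.le
  have hev' : ∀ᶠ n : ℕ in atTop, ∀ p : unitInterval, (p : ℝ) ≤ criticalProbI 3 + δ →
      ∑ j ∈ Finset.range (n + 1), oneArmProb 3 p j ≤ 1 / (4 * (|M| + 1)) * ((n + 1 : ℕ) : ℝ) := (tendsto_add_atTop_nat 1).eventually hev
  filter_upwards [hfix, hband, hnear, hev'] with n hfixn hbandn hnearn hSn
  have hu0 : 0 < (u n : ℝ) := lt_of_lt_of_le hε hbandn.1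
  have hu1 : (u n : ℝ) < 1 := by linarith [hbandn.2]
  have hge := rg_deriv_ge_osss n (u n) hu0 hu1 hfixn
  have hS := hSn (u n) hnearn
  push_cast at hS
  set S : ℝ := ∑ j ∈ Finset.range (n + 1), oneArmProb 3 (u n) j with hSdef
  have hS1 : 1 ≤ S := by
    have h0 : oneArmProb 3 (u n) 0 = 1 := FiniteSizeSharpness.real_siteToBoundary_zero (d := 3) (by norm_num) (u n)
    have : oneArmProb 3 (u n) 0 ≤ S := by
      rw [hSdef]; exact Finset.single_le_sum (f := fun j => oneArmProb 3 (u n) j) (fun _ _ => measureReal_nonneg)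
        (Finset.mem_range.2 (Nat.succ_pos n))
    linarith
  have hSpos : 0 < 4 * S := by linarith
  -- `(n+1)/(4S) ≥ |M| + 1` because `4S ≤ (n+1)/(|M|+1)`
  have hM1 : 0 < |M| + 1 := by positivity
  have h4S : 4 * S ≤ ((n : ℝ) + 1) / (|M| + 1) := by
    rw [le_div_iff₀ hM1]
    have : S ≤ 1 / (4 * (|M| + 1)) * ((n : ℝ) + 1) := hS
    rw [div_mul_eq_mul_div, le_div_iff₀ (by positivity)] at this
    linarith
  have hkey : |M| + 1 ≤ ((n : ℝ) + 1) / (4 * S) := by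
    rw [le_div_iff₀ hSpos]
    rw [le_div_iff₀ hM1] at h4S
    linarith
  linarith [le_abs_self M]

end Summit.CriticalPhenomena.PercolationContinuityZ3.Theorems.Crossing

end
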